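import Summits.ValiantsHypothesis.ValiantsHypothesis.Theorems.NewtonUnitEquationsTwoProductsRankOneThreeLawLaw
import Summits.ValiantsHypothesis.ValiantsHypothesis.Theorems.NewtonUnitEquationsTwoProductsFormalLogLinearisationShiftRankCell
import HarnessLib

/-!
# Route NewtonUnitEquations — crux `TwoProducts` (stmt-ValiantsHypothesis-5906), line `relation_ladder`, rung R7a (three-term
# rank one, GENERAL shape `α = qβ + rγ`, `q, r ≥ 1`): the FREE LIFT with DOUBLE SLICING — `RankOneThreeFreeLaw` — part 1/6 — relation data with coefficients, the free substitution `Y_α ↦ Y_β^q Y_γ^r`, fibres, multinomial regrouping (T2–T3)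

(T2) `QIdx` (three distinct indices + coefficients `q, r ≥ 1`), the free substitution `frM`, coordinates of toric images; (T3) reduced exponents, the fibre parametrisation `Lof`/`KR`, `Bk`, the slice normaliser `Pfac`, `kap`, `multinomial_Lof_eq`, fibre sums `coeff_phiT_frM`.

val-idea-8 g3 (ideator; lens decomp), 2026-08-28. Generalises the R6b module (`α = β + γ`, val-lit-p3 g15's port `…RankOneThreeLaw*`,
imported): the substitution `Y_α ↦ Y_β^q Y_γ^r` has fibres `{x + k(e_α − q e_β − r e_γ)}` of letter count `n_k = R + B_k`, `R = Σ_{rest} x_j`,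
`B_k = x_β + x_γ − (q+r−1)k ≥ 0`; slicing BOTH relation coordinates `(b₁, b₂) = (x_β, x_γ)` makes `multinomial(L_k)/n_k = Pfac(x) ·
C(R + B_k − 1, B_k) · κ_k` EXACT with `Pfac = (R−1)!/∏_{rest} x_j!`, so the slice functions are R6b's with `(b − k) ↦ B_k` and no binomial
character — finite SHIFT RANK, and val-lit-p3's `ShiftRank.pencilCount` applies BY NAME.  Large coefficients (`q > m` or `r > m`) force
permutation type (`msetT a e ≤ m`), handled by R3♯ `permTypeLaw_proof`.

PORT NOTE (val-lit-p3 g15, prover seat, helper mode `--supports stmt-ValiantsHypothesis-5906 --as helper`, no stub credit claimed; the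
author's invitation val-width INBOX 11:42Z + desk RULING #279 (c)): part 1/6 of a VERBATIM Theorems-side port of val-idea-8 g3's sorry-free
module `Cruxes/TwoProducts/Lines/relation_ladder_R7a.lean` (tree @0a494ab61a34; sha256 2455bfd4f3ef04f6…; 1 627 lines; `lean check` rc 0,
0 sorries, 0 warnings). ALL mathematics and ALL proofs are val-idea-8 g3's (engine memo `Lines/relation_ladder_R7_engine.md` rev 2 §7).  The
port changes only: (i) the file split and the import chain; (ii) declarations that the source re-declares VERBATIM from the landed R6b port
(`sum_sgn`, `HSD` + `HSD.mul/mulHom/homMul/constMul/sum/add`, `hsd_binChar`, `rW_pos`) or from the R6 port (`tab`, `sgn`, `rW`,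
`toolBound_mono`) or from `…FormalLogLinearisationStubRaysRung` (`wt_nsmul'` = `wt_nsmul`) are NOT re-declared but referenced BY NAME
(`R6b.…` for the sibling namespace); (iii) the section variables are renamed `I ↦ Iq` (the `QIdx` datum) and `D ↦ Dq` (the `RelData`
datum) — a pure α-renaming forced by the gate's statement-text index (`dedup.landed` keys on declaration text, namespace-blind, and
the R6b port owns same-text lemmas over `ThreeIdx`); (iv) one-line docstrings on API lemmas; (v) in part 6/6 the parameter-free
`def RankOneThreeFreeLaw : Prop` is NOT declared (relocation rule) — the law is stated by its LITERAL body as `rankOneThreeFreeLaw_proof`.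
Namespace = the author's (`…PermutationType.R7a`).  Nothing here closes the line's residual, the crux `TwoProducts` (5906) or `VP ≠ VNP`;
no summit statement is proved.

Honest scope (the author's): relations with the lone letter carrying a coefficient `p ≥ 2` (e.g. `2β = α + γ` = R6c, `pβ = qα + rγ`), two-letter
`pα = qβ`, support ≥ 4 and coincidence rank ≥ 2 are NOT covered here.  Nothing here moves VP ≠ VNP; `TwoProducts` (5906) stays OPEN. [folklore]

Cut table (source line ranges of `Lines/relation_ladder_R7a.lean` @0a494ab61a34): part 1 `…Free` = l. 32–346 (T2–T3: `QIdx`, `frM`, fibres,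
`Bk`, `Pfac`, `kap`, `multinomial_Lof_eq`, `coeff_phiT_frM`); part 2 `…Slice` = l. 347–508 (T4: slice functions, THE COEFFICIENT THEOREM
`coeff_free_logTrunc`); part 3 `…SliceExc` = l. 509–720 (exceptional exponents, support criterion, `xOf`); part 4 `…ShiftPlanar` = l. 722–1111
(T5 finite shift rank `Fsl_shift`; T7 planar `RelData`, injectivity, weights); part 5 `…Count` = l. 1113–1377 (T8 `sliceMin_of_visible`,
`sliceCount`, `RelData.count`); part 6 `…Law` = l. 1378–1621 (large/absent coefficients ⇒ permutation type, arithmetic `arith_R7a`, the law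
`rankOneThreeFreeLaw_proof`).  Dropped as duplicates of landed decls: l. 350–358, 726–797, 1059–1063, 1074–1077, 1236–1245; l. 1548–1557
(`def RankOneThreeFreeLaw`) replaced by the literal body.
-/

noncomputable section

-- Sub = Summit single-conjunct layout: the duplicated namespace component is mandated by the tree.
set_option linter.dupNamespace false
set_option linter.unusedSimpArgs false
set_option linter.deprecated false
set_option linter.unusedSectionVars false
set_option linter.unusedVariables false
set_option linter.unnecessarySeqFocus false

namespace Summit.ValiantsHypothesis.ValiantsHypothesis.Theorems.NewtonUnitEquations.TwoProducts.PermutationType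
namespace R7a
open scoped BigOperators
open MvPolynomial

variable {σ : Type*} [Fintype σ] [DecidableEq σ]


/-! ## Part T2: relation indices with coefficients and the FREE substitution `Y_a ↦ Y_b^q Y_c^r` -/

/-- Three distinct indices and the two coefficients of the relation `α = q β + r γ` (`q, r ≥ 1`). [folklore] -/
structure QIdx (σ : Type*) where
  /-- index of `α` (idle upstairs) -/
  a : σ
  /-- index of `β` (first slice coordinate) -/
  b : σ
  /-- index of `γ` (second slice coordinate) -/
  c : σ
  /-- coefficient of `β` -/
  q : ℕ
  /-- coefficient of `γ` -/
  r : ℕ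
  hq : 1 ≤ q
  hr : 1 ≤ r
  hab : a ≠ b
  hac : a ≠ c
  hbc : b ≠ c

variable (Iq : QIdx σ)

/-- The free substitution on letters: `α ↦ q β + r γ`, all other letters unchanged. [folklore] -/
def frM (i : σ) : σ →₀ ℕ :=
  if i = Iq.a then Finsupp.single Iq.b Iq.q + Finsupp.single Iq.c Iq.r else Finsupp.single i 1

/-- `frM_a` — technical lemma of the R7a free-lift toolkit (val-idea-8 g3). [folklore] -/
theorem frM_a : frM Iq Iq.a = Finsupp.single Iq.b Iq.q + Finsupp.single Iq.c Iq.r := by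
  unfold frM; rw [if_pos rfl]

/-- `frM_other` — technical lemma of the R7a free-lift toolkit (val-idea-8 g3). [folklore] -/
theorem frM_other (i : σ) (ha : i ≠ Iq.a) : frM Iq i = Finsupp.single i 1 := by
  unfold frM; rw [if_neg ha]

/-- `frM_ne_zero` — technical lemma of the R7a free-lift toolkit (val-idea-8 g3). [folklore] -/
theorem frM_ne_zero (i : σ) : frM Iq i ≠ 0 := by
  have hq := Iq.hq
  unfold frM
  split_ifs <;> intro h
  · have := DFunLike.congr_fun h Iq.b
    simp [Finsupp.single_apply, Iq.hbc, Iq.hbc.symm] at this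
    omega
  · have := DFunLike.congr_fun h i; simp at this

/-- The `a`-coordinate of a toric image vanishes. [folklore] -/
theorem piT_frM_a (L : σ →₀ ℕ) : piT (frM Iq) L Iq.a = 0 := by
  have F := And.intro Iq.hab (And.intro Iq.hac Iq.hbc)
  rw [piT_apply]
  refine Finset.sum_eq_zero fun i _ => ?_
  unfold frM
  split_ifs with h1 <;>
    simp [Finsupp.single_apply, h1, F.1, F.2.1, F.2.2, F.1.symm, F.2.1.symm, F.2.2.symm]

/-- The `b`-coordinate of a toric image: `q #α + #β`. [folklore] -/
theorem piT_frM_b (L : σ →₀ ℕ) : piT (frM Iq) L Iq.b = Iq.q * L Iq.a + L Iq.b := by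
  have F := And.intro Iq.hab (And.intro Iq.hac Iq.hbc)
  rw [piT_apply]
  have key : ∀ i, L i * (frM Iq i) Iq.b = (if i = Iq.a then Iq.q * L i else 0) + (if i = Iq.b then L i else 0) := by
    intro i
    unfold frM
    split_ifs with h1 h2 <;>
      simp [Finsupp.single_apply, F.1, F.2.1, F.2.2, F.1.symm, F.2.1.symm, F.2.2.symm] <;> simp_all <;> ring
  simp only [key, Finset.sum_add_distrib, Finset.sum_ite_eq', Finset.mem_univ, if_true]

/-- The `c`-coordinate of a toric image: `r #α + #γ`. [folklore] -/
theorem piT_frM_c (L : σ →₀ ℕ) : piT (frM Iq) L Iq.c = Iq.r * L Iq.a + L Iq.c := by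
  have F := And.intro Iq.hab (And.intro Iq.hac Iq.hbc)
  rw [piT_apply]
  have key : ∀ i, L i * (frM Iq i) Iq.c = (if i = Iq.a then Iq.r * L i else 0) + (if i = Iq.c then L i else 0) := by
    intro i
    unfold frM
    split_ifs with h1 h2 <;>
      simp [Finsupp.single_apply, F.1, F.2.1, F.2.2, F.1.symm, F.2.1.symm, F.2.2.symm] <;> simp_all <;> ring
  simp only [key, Finset.sum_add_distrib, Finset.sum_ite_eq', Finset.mem_univ, if_true]

/-- Other coordinates of a toric image are unchanged. [folklore] -/
theorem piT_frM_other (L : σ →₀ ℕ) (j : σ) (ha : j ≠ Iq.a) (hb : j ≠ Iq.b) (hc : j ≠ Iq.c) : piT (frM Iq) L j = L j := by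
  have F := And.intro Iq.hab (And.intro Iq.hac Iq.hbc)
  rw [piT_apply]
  have key : ∀ i, L i * (frM Iq i) j = (if i = j then L i else 0) := by
    intro i
    unfold frM
    split_ifs with h1 h2 <;>
      simp [Finsupp.single_apply, ha, hb, hc, Ne.symm ha, Ne.symm hb, Ne.symm hc,
        F.1, F.2.1, F.2.2, F.1.symm, F.2.1.symm, F.2.2.symm] <;> simp_all
  simp only [key]
  rw [Finset.sum_ite_eq']; simp

/-! ## Part T3: the three special coordinates, the reduced exponent (all three zeroed), the fibres -/

/-- The three relation indices as a finset. [folklore] -/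
def threeSet : Finset σ := {Iq.a, Iq.b, Iq.c}

/-- The remaining indices. [folklore] -/
def rest : Finset σ := Finset.univ \ threeSet Iq

/-- `mem_rest` — technical lemma of the R7a free-lift toolkit (val-idea-8 g3). [folklore] -/
theorem mem_rest (j : σ) : j ∈ rest Iq ↔ j ≠ Iq.a ∧ j ≠ Iq.b ∧ j ≠ Iq.c := by
  classical
  unfold rest threeSet
  simp only [Finset.mem_sdiff, Finset.mem_univ, true_and, Finset.mem_insert, Finset.mem_singleton, not_or]

/-- `prod_three_split` — technical lemma of the R7a free-lift toolkit (val-idea-8 g3). [folklore] -/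
theorem prod_three_split {β : Type*} [CommMonoid β] (f : σ → β) :
    ∏ j, f j = (∏ j ∈ rest Iq, f j) * (f Iq.a * (f Iq.b * f Iq.c)) := by
  classical
  unfold rest threeSet
  rw [← Finset.prod_sdiff (Finset.subset_univ ({Iq.a, Iq.b, Iq.c} : Finset σ))]
  congr 1
  rw [Finset.prod_insert (by simp [Iq.hab, Iq.hac]), Finset.prod_pair Iq.hbc]

/-- `sum_three_split` — technical lemma of the R7a free-lift toolkit (val-idea-8 g3). [folklore] -/
theorem sum_three_split {β : Type*} [AddCommMonoid β] (f : σ → β) :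
    ∑ j, f j = (∑ j ∈ rest Iq, f j) + (f Iq.a + (f Iq.b + f Iq.c)) := by
  classical
  unfold rest threeSet
  rw [← Finset.sum_sdiff (Finset.subset_univ ({Iq.a, Iq.b, Iq.c} : Finset σ))]
  congr 1
  rw [Finset.sum_insert (by simp [Iq.hab, Iq.hac]), Finset.sum_pair Iq.hbc]

/-- The reduced exponent `x̂`: the coordinates `a, b, c` set to zero. [folklore] -/
def xhat (x : σ →₀ ℕ) : σ →₀ ℕ := ofFun fun j => if j = Iq.a ∨ j = Iq.b ∨ j = Iq.c then 0 else x j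

/-- `xhat_a` — technical lemma of the R7a free-lift toolkit (val-idea-8 g3). [folklore] -/
theorem xhat_a (x : σ →₀ ℕ) : xhat Iq x Iq.a = 0 := by
  classical simp [xhat]

/-- `xhat_b` — technical lemma of the R7a free-lift toolkit (val-idea-8 g3). [folklore] -/
theorem xhat_b (x : σ →₀ ℕ) : xhat Iq x Iq.b = 0 := by
  classical simp [xhat]

/-- `xhat_c` — technical lemma of the R7a free-lift toolkit (val-idea-8 g3). [folklore] -/
theorem xhat_c (x : σ →₀ ℕ) : xhat Iq x Iq.c = 0 := by
  classical simp [xhat]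

/-- `xhat_other` — technical lemma of the R7a free-lift toolkit (val-idea-8 g3). [folklore] -/
theorem xhat_other (x : σ →₀ ℕ) (j : σ) (ha : j ≠ Iq.a) (hb : j ≠ Iq.b) (hc : j ≠ Iq.c) : xhat Iq x j = x j := by
  classical simp [xhat, ha, hb, hc]

/-- `xhat_rest` — technical lemma of the R7a free-lift toolkit (val-idea-8 g3). [folklore] -/
theorem xhat_rest (x : σ →₀ ℕ) (j : σ) (hj : j ∈ rest Iq) : xhat Iq x j = x j := by
  rw [mem_rest] at hj; exact xhat_other Iq x j hj.1 hj.2.1 hj.2.2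

/-- The letter multiset in the fibre over `x` with `#α = k`: `#β = x b - q k, #γ = x c - r k`. [folklore] -/
def Lof (x : σ →₀ ℕ) (k : ℕ) : σ →₀ ℕ :=
  ofFun fun j => if j = Iq.a then k else if j = Iq.b then x Iq.b - Iq.q * k else if j = Iq.c then x Iq.c - Iq.r * k else x j

/-- `Lof_a` — technical lemma of the R7a free-lift toolkit (val-idea-8 g3). [folklore] -/
theorem Lof_a (x : σ →₀ ℕ) (k : ℕ) : Lof Iq x k Iq.a = k := by
  classical simp [Lof]

/-- `Lof_b` — technical lemma of the R7a free-lift toolkit (val-idea-8 g3). [folklore] -/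
theorem Lof_b (x : σ →₀ ℕ) (k : ℕ) : Lof Iq x k Iq.b = x Iq.b - Iq.q * k := by
  classical simp [Lof, Iq.hab.symm]

/-- `Lof_c` — technical lemma of the R7a free-lift toolkit (val-idea-8 g3). [folklore] -/
theorem Lof_c (x : σ →₀ ℕ) (k : ℕ) : Lof Iq x k Iq.c = x Iq.c - Iq.r * k := by
  classical simp [Lof, Iq.hac.symm, Iq.hbc.symm]

/-- `Lof_other` — technical lemma of the R7a free-lift toolkit (val-idea-8 g3). [folklore] -/
theorem Lof_other (x : σ →₀ ℕ) (k : ℕ) (j : σ) (ha : j ≠ Iq.a) (hb : j ≠ Iq.b) (hc : j ≠ Iq.c) : Lof Iq x k j = x j := by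
  classical simp [Lof, ha, hb, hc]

/-- The admissible range of `k = #α` in the fibre over `x`: `q k ≤ x b`, `r k ≤ x c`. [folklore] -/
def KR (x : σ →₀ ℕ) : Finset ℕ := (Finset.range (x Iq.b + x Iq.c + 1)).filter fun k => Iq.q * k ≤ x Iq.b ∧ Iq.r * k ≤ x Iq.c

/-- `le_qmul` — technical lemma of the R7a free-lift toolkit (val-idea-8 g3). [folklore] -/
theorem le_qmul (k : ℕ) : k ≤ Iq.q * k := Nat.le_mul_of_pos_left k Iq.hq
/-- `le_rmul` — technical lemma of the R7a free-lift toolkit (val-idea-8 g3). [folklore] -/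
theorem le_rmul (k : ℕ) : k ≤ Iq.r * k := Nat.le_mul_of_pos_left k Iq.hr

/-- `mem_KR` — technical lemma of the R7a free-lift toolkit (val-idea-8 g3). [folklore] -/
theorem mem_KR (x : σ →₀ ℕ) (k : ℕ) : k ∈ KR Iq x ↔ Iq.q * k ≤ x Iq.b ∧ Iq.r * k ≤ x Iq.c := by
  unfold KR
  rw [Finset.mem_filter, Finset.mem_range]
  have h1 := le_qmul Iq k
  constructor
  · exact fun h => h.2
  · intro h; exact ⟨by omega, h⟩

/-- (F1) Every preimage of `x` is an `Lof x k` with `k` admissible (and `x a = 0`). [folklore] -/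
theorem eq_Lof_of_piT (L x : σ →₀ ℕ) (h : piT (frM Iq) L = x) :
    x Iq.a = 0 ∧ L Iq.a ∈ KR Iq x ∧ L = Lof Iq x (L Iq.a) := by
  have ha := piT_frM_a Iq L; have hb := piT_frM_b Iq L; have hc := piT_frM_c Iq L
  rw [h] at ha hb hc
  refine ⟨ha, (mem_KR Iq x _).2 ⟨by omega, by omega⟩, ?_⟩
  ext j
  by_cases hja : j = Iq.a
  · subst hja; rw [Lof_a]
  by_cases hjb : j = Iq.b
  · subst hjb; rw [Lof_b]; omega
  by_cases hjc : j = Iq.c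
  · subst hjc; rw [Lof_c]; omega
  rw [Lof_other Iq x _ j hja hjb hjc, ← h, piT_frM_other Iq L j hja hjb hjc]

/-- (F2) Every admissible `Lof x k` lies in the fibre over `x` (when `x a = 0`). [folklore] -/
theorem piT_Lof (x : σ →₀ ℕ) (hx : x Iq.a = 0) (k : ℕ) (hk : k ∈ KR Iq x) : piT (frM Iq) (Lof Iq x k) = x := by
  rw [mem_KR] at hk
  ext j
  by_cases hja : j = Iq.a
  · subst hja; rw [piT_frM_a, hx]
  by_cases hjb : j = Iq.b
  · subst hjb; rw [piT_frM_b, Lof_a, Lof_b]; omega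
  by_cases hjc : j = Iq.c
  · subst hjc; rw [piT_frM_c, Lof_a, Lof_c]; omega
  rw [piT_frM_other Iq _ j hja hjb hjc, Lof_other Iq x k j hja hjb hjc]

/-- The degree of the reduced exponent: `R = Σ_{rest} x_j`. [folklore] -/
theorem deg_xhat (x : σ →₀ ℕ) : deg (xhat Iq x) = ∑ j ∈ rest Iq, x j := by
  rw [deg_eq_sum, sum_three_split Iq, xhat_a, xhat_b, xhat_c, zero_add, add_zero, add_zero]
  exact Finset.sum_congr rfl fun j hj => xhat_rest Iq x j hj

/-- The full degree in terms of the reduced one. [folklore] -/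
theorem deg_eq_deg_xhat_add (x : σ →₀ ℕ) : deg x = deg (xhat Iq x) + (x Iq.a + (x Iq.b + x Iq.c)) := by
  rw [deg_xhat, deg_eq_sum, sum_three_split Iq]

/-- (F4) The degree along the fibre: `deg (Lof x k) + q k + r k = R + x b + x c + k`. [folklore] -/
theorem deg_Lof (x : σ →₀ ℕ) (k : ℕ) (hk : k ∈ KR Iq x) :
    deg (Lof Iq x k) + Iq.q * k + Iq.r * k = deg (xhat Iq x) + x Iq.b + x Iq.c + k := by
  rw [mem_KR] at hk
  rw [deg_xhat, deg_eq_sum, sum_three_split Iq, Lof_a, Lof_b, Lof_c]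
  have : ∑ j ∈ rest Iq, (Lof Iq x k) j = ∑ j ∈ rest Iq, x j := by
    refine Finset.sum_congr rfl fun j hj => ?_
    rw [mem_rest] at hj
    rw [Lof_other Iq x k j hj.1 hj.2.1 hj.2.2]
  rw [this]; omega

/-- The letter-count excess `B_k = x_b + x_c + k − q k − r k` of the fibre element `L_k` over `R`. [folklore] -/
def Bk (b₁ b₂ k : ℕ) : ℕ := b₁ + b₂ + k - (Iq.q * k + Iq.r * k)

/-- `deg_Lof_eq` — technical lemma of the R7a free-lift toolkit (val-idea-8 g3). [folklore] -/
theorem deg_Lof_eq (x : σ →₀ ℕ) (k : ℕ) (hk : k ∈ KR Iq x) :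
    deg (Lof Iq x k) = deg (xhat Iq x) + Bk Iq (x Iq.b) (x Iq.c) k := by
  have h := deg_Lof Iq x k hk
  rw [mem_KR] at hk
  unfold Bk; omega

/-- The slice normaliser `(R - 1)! / ∏_{rest} x_j!` (nonzero). [folklore] -/
def Pfac (x : σ →₀ ℕ) : ℂ :=
  (((deg (xhat Iq x) - 1).factorial : ℕ) : ℂ) / (((∏ j ∈ rest Iq, (x j).factorial : ℕ)) : ℂ)

/-- `Pfac_ne_zero` — technical lemma of the R7a free-lift toolkit (val-idea-8 g3). [folklore] -/
theorem Pfac_ne_zero (x : σ →₀ ℕ) : Pfac Iq x ≠ 0 := by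
  unfold Pfac
  refine div_ne_zero (Nat.cast_ne_zero.mpr (Nat.factorial_ne_zero _)) (Nat.cast_ne_zero.mpr ?_)
  exact Finset.prod_ne_zero_iff.mpr fun j _ => Nat.factorial_ne_zero _

/-- The fibre constant `κ_k = B_k! / (k! (b₁ − q k)! (b₂ − r k)!)`. [folklore] -/
def kap (b₁ b₂ k : ℕ) : ℂ :=
  (((Bk Iq b₁ b₂ k).factorial : ℕ) : ℂ) / (((k.factorial * (b₁ - Iq.q * k).factorial * (b₂ - Iq.r * k).factorial : ℕ)) : ℂ)

/-- (F5) **Multinomial regrouping along the fibre** (varying letter count, double slicing):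
`multinomial(L_k) = Pfac(x) · C(R + B_k − 1, B_k) · κ_k · deg(L_k)` for `R = deg x̂ ≥ 1`. [folklore] -/
theorem multinomial_Lof_eq (x : σ →₀ ℕ) (k : ℕ) (hk : k ∈ KR Iq x) (h1 : 1 ≤ deg (xhat Iq x)) :
    ((Lof Iq x k).multinomial : ℂ) =
      Pfac Iq x * (((deg (xhat Iq x) + Bk Iq (x Iq.b) (x Iq.c) k - 1).choose (Bk Iq (x Iq.b) (x Iq.c) k) : ℕ) : ℂ) *
        kap Iq (x Iq.b) (x Iq.c) k * ((deg (Lof Iq x k) : ℕ) : ℂ) := by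
  have hk' := (mem_KR Iq x k).1 hk
  have hdeg := deg_Lof_eq Iq x k hk
  set Dq := deg (xhat Iq x) with hD
  set B := Bk Iq (x Iq.b) (x Iq.c) k with hB
  set n := deg (Lof Iq x k) with hn
  have sL := Nat.multinomial_spec (Finset.univ : Finset σ) (Lof Iq x k)
  rw [← multinomial_univ, ← deg_eq_sum] at sL
  rw [prod_three_split Iq, Lof_a, Lof_b, Lof_c] at sL
  have hr : ∏ j ∈ rest Iq, ((Lof Iq x k) j).factorial = ∏ j ∈ rest Iq, (x j).factorial := by
    refine Finset.prod_congr rfl fun j hj => ?_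
    rw [mem_rest] at hj
    rw [Lof_other Iq x k j hj.1 hj.2.1 hj.2.2]
  rw [hr, ← hn] at sL
  -- factorial identities
  have h2 : (Dq + B - 1).choose B * B.factorial * (Dq - 1).factorial = (Dq + B - 1).factorial := by
    have := Nat.choose_mul_factorial_mul_factorial (n := Dq + B - 1) (k := B) (by omega)
    rwa [show Dq + B - 1 - B = Dq - 1 by omega] at this
  have h3 : n.factorial = n * (Dq + B - 1).factorial := by
    rw [show n = (Dq + B - 1) + 1 by omega, Nat.factorial_succ]
  set P : ℂ := ∏ j ∈ rest Iq, ((((x j).factorial : ℕ)) : ℂ) with hP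
  set Kd : ℂ := ((k.factorial : ℕ) : ℂ) * (((x Iq.b - Iq.q * k).factorial : ℕ) : ℂ) * (((x Iq.c - Iq.r * k).factorial : ℕ) : ℂ)
    with hKd
  have hPne : P ≠ 0 := Finset.prod_ne_zero_iff.mpr fun j _ => Nat.cast_ne_zero.mpr (Nat.factorial_ne_zero _)
  have hKdne : Kd ≠ 0 :=
    mul_ne_zero (mul_ne_zero (Nat.cast_ne_zero.mpr (Nat.factorial_ne_zero _)) (Nat.cast_ne_zero.mpr (Nat.factorial_ne_zero _)))
      (Nat.cast_ne_zero.mpr (Nat.factorial_ne_zero _))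
  have key : ((Lof Iq x k).multinomial : ℂ) * (P * Kd) =
      (n : ℂ) * ((((Dq + B - 1).choose B : ℕ) : ℂ) * ((B.factorial : ℕ) : ℂ) * (((Dq - 1).factorial : ℕ) : ℂ)) := by
    have e : ((((∏ j ∈ rest Iq, (x j).factorial) * (k.factorial * ((x Iq.b - Iq.q * k).factorial * (x Iq.c - Iq.r * k).factorial)) *
        (Lof Iq x k).multinomial : ℕ)) : ℂ) = ((n.factorial : ℕ) : ℂ) := by exact_mod_cast sL
    rw [h3, ← h2] at e
    push_cast at e
    rw [hP, hKd]
    linear_combination e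
  have hPf : Pfac Iq x = (((Dq - 1).factorial : ℕ) : ℂ) / P := by
    unfold Pfac; rw [hP]; push_cast; rfl
  have hkap : kap Iq (x Iq.b) (x Iq.c) k = ((B.factorial : ℕ) : ℂ) / Kd := by
    unfold kap; rw [hKd, hB]; push_cast; rfl
  rw [hPf, hkap]
  calc ((Lof Iq x k).multinomial : ℂ) = ((Lof Iq x k).multinomial : ℂ) * (P * Kd) / (P * Kd) := by
        field_simp
    _ = (n : ℂ) * ((((Dq + B - 1).choose B : ℕ) : ℂ) * ((B.factorial : ℕ) : ℂ) * (((Dq - 1).factorial : ℕ) : ℂ)) / (P * Kd) := by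
        rw [key]
    _ = (((Dq - 1).factorial : ℕ) : ℂ) / P * ((((Dq + B - 1).choose B : ℕ)) : ℂ) * (((B.factorial : ℕ) : ℂ) / Kd) * (n : ℂ) := by
        field_simp


end R7a
end Summit.ValiantsHypothesis.ValiantsHypothesis.Theorems.NewtonUnitEquations.TwoProducts.PermutationType

end
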